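import Summits.BirchSwinnertonDyer.BirchSwinnertonDyer.Theorems.AlignedTransportAtTwoMainConjectureOfRankZeroBSDAtTwoSexticNormRelationDescentSignFreeAdjoinI
import Summits.BirchSwinnertonDyer.BirchSwinnertonDyer.Theorems.AlignedTransportAtTwoMainConjectureOfRankZeroBSDAtTwoSexticNormRelationDescentSignFreeOneRoot
import Summits.BirchSwinnertonDyer.BirchSwinnertonDyer.Theorems.AlignedTransportAtTwoMainConjectureOfRankZeroBSDAtTwoSexticNormRelationDescentSignFreeIff
import Literature.NumberTheory.IwasawaTheory.ClassicalMuVanishesQuadraticAscentSqrt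
import Literature.NumberTheory.EllipticCurves.FineSelmerLimThm35AtTwoUpstairsProofs
import HarnessLib

/-!
# Route `AlignedTransportAtTwo`, crux C2 `MainConjectureOfRankZeroBSDAtTwo` (stmt-BirchSwinnertonDyer-22298):
# THE `C₂`-STEP `ℚ(W[2]) → ℚ(W[2], √−1)` ON `Δ_W < 0`, KERNEL — PFμ⁺'s conclusion from `μ₂ = 0` of ONE cubic `2`-torsion field

Sequel of `…SexticNormRelationDescentSignFree{AdjoinI,OneRoot,Iff}` (same seat bsd-line-att-p4 g29). HONEST FRAMING: WIDTH-5 attached prover seat on line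
`birth` of the lead `bsd-line-att-p2`; `--supports` stmt-BirchSwinnertonDyer-22298, closes nothing; BSD is NOT proved; crux C2, its verdict «blocked-on
`Rank1Residual.GreenbergMuConjectureIrreducible`» and every registered stub untouched (PFμ⁺ = `PointFieldMuCycAtTwo` stays OPEN: this file proves its
CONCLUSION only on the `Δ_W < 0` half and only from the cubic `μ₂`-datum). THEOREMS ONLY.

WHAT. att-p4 g28's reading «the remaining print step of PFμ⁺ is the `C₂`-step `ℚ(W[2]) → ℚ(W[2], i)` (Iwasawa 1973 / Kida; no odd-denominator norm
relation for `C₂`)» is discharged IN THE KERNEL on `Δ_W < 0` by cell bsd-2adic's proved ascent `classicalMuVanishes_restrict_rat_of_sq_eq` (Iwasawa's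
`ℓ = 2` ascent `K(√m)/K` for `K` with at most one real embedding, `K(√m)` totally complex): here `K = ℚ(W[2])` is totally complex (`Δ_W < 0`), `m = −1`,
and the one missing input — `κ ∘ res` ONTO `Γ_{ℚ(W[2], i)}` (degree `12`) — is part AdjoinI's `surjective_gal_restrict_sup_adjoin_I` (this seat's degree-free
criterion + `√2 ∉ ℚ(W[2], i)`).

* ★★ `classicalMuVanishes_sup_adjoin_I_of_divisionField_two_of_Δ_neg` — `W/ℚ` elliptic, no rational `2`-torsion abscissa, `Δ_W < 0`, `−2Δ_W ∉ ℚ²`,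
  `i² = −1`: **`μ₂ = 0` for every cyclotomic `ℤ₂`-extension of `ℚ(W[2])` ⟹ `μ₂ = 0` for every cyclotomic `ℤ₂`-extension of `ℚ(W[2]) ⊔ ℚ⟮i⟯`**
  (if `i ∈ ℚ(W[2])` this is the finite descent along `ℚ(W[2]) ⊔ ℚ⟮i⟯ ≤ ℚ(W[2])`; else `[ℚ(W[2], i) : ℚ(W[2])] = 2` and the ascent applies).
* ★★★ `classicalMuVanishes_sup_adjoin_I_of_single_cubic_of_Δ_neg` — same `W`: **`μ₂ = 0` for the cyclotomic `ℤ₂`-extensions of ONE cubic field `ℚ(β_j)`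
  ⟹ `μ₂ = 0` for every cyclotomic `ℤ₂`-extension of `ℚ(W[2], √−1)`** — the CONCLUSION of the registered stub PFμ⁺ for this `W`, from the cubic datum
  alone, through part OneRoot (three cubic towers from one), part Iff (`μ₂(ℚ(√Δ_W)) = 0` free on `Δ_W < 0`), part B (the `S₃` descent) and the `C₂`-step.
* `…_of_isOrdinaryAt_of_Δ_neg` — on C2's binders (`−2Δ_W ∉ ℚ²` automatic).

So on the `Δ_W < 0` half-cell the whole field diagram `ℚ(β) ⊂ ℚ(W[2]) ⊂ ℚ(W[2], i)` carries `μ₂ = 0` upward in the kernel; the `0 < Δ_W` half still needs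
unit-signature / narrow data at the `C₂`-step (`ℚ(W[2])` totally real). Nothing closed.

References: [Iwasawa1973MuInvariants] Thm. 2/3, §4; [Washington1997] §13.1, §13.3 Prop. 13.23; [BiasseEtAl2022] Prop. 3.7; tree: parts AdjoinI/OneRoot/Iff (this
seat), `ClassicalMuVanishesQuadraticAscentSqrt` and `ClassicalMuVanishesAdjoinIOfNarrow` (cell bsd-2adic, proof pattern of `hgen`), `FineSelmerLimThm35AtTwoUpstairsProofs`.
-/

set_option linter.dupNamespace false
set_option autoImplicit false

noncomputable section

open scoped Classical NumberField

namespace Summit.BirchSwinnertonDyer.BirchSwinnertonDyer.Theorems.AlignedTransportAtTwoSexticNormRelationDescentAdjoinIAscent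

open NumberField Polynomial WeierstrassCurve IntermediateField Field
  Literature.NumberTheory.EllipticCurves Literature.NumberTheory.EllipticCurves.Greenberg1999
  Literature.NumberTheory.EllipticCurves.DokchitserDokchitser2012
  Literature.NumberTheory.EllipticCurves.ZpExtension Literature.NumberTheory.GaloisRepresentations
  Literature.NumberTheory.IwasawaTheory Literature.NumberTheory.NumberFields
  Summit.BirchSwinnertonDyer.BirchSwinnertonDyer.Theorems.AlignedTransportAtTwoFineRoad.DivisionCubic
  Summit.BirchSwinnertonDyer.BirchSwinnertonDyer.Theorems.AlignedTransportAtTwoFineRoad.TowerImageDelta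
  Summit.BirchSwinnertonDyer.BirchSwinnertonDyer.Theorems.AlignedTransportAtTwoSexticTowerGrowth
  Summit.BirchSwinnertonDyer.BirchSwinnertonDyer.Theorems.AlignedTransportAtTwoSexticNormRelationDescent
  Summit.BirchSwinnertonDyer.BirchSwinnertonDyer.Theorems.AlignedTransportAtTwoSexticNormRelationDescentSignFree
  Summit.BirchSwinnertonDyer.BirchSwinnertonDyer.Theorems.AlignedTransportAtTwoSexticNormRelationDescentSignFreeIff
  Summit.BirchSwinnertonDyer.BirchSwinnertonDyer.Theorems.AlignedTransportAtTwoSexticNormRelationDescentSignFreeOneRoot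
  Summit.BirchSwinnertonDyer.BirchSwinnertonDyer.Theorems.AlignedTransportAtTwoSexticNormRelationDescentSignFreeAdjoinI

/-- A totally complex number field has no ring morphism to `ℝ`. [folklore] -/
private theorem false_of_ringHom_real {K' : Type} [Field K'] [NumberField K'] [IsTotallyComplex K'] (ρ : K' →+* ℝ) : False := by
  have h : ComplexEmbedding.IsReal (Complex.ofRealHom.comp ρ) := by
    rw [ComplexEmbedding.isReal_iff]
    ext x
    simp [ComplexEmbedding.conjugate_coe_eq]
  exact IsTotallyComplex.complexEmbedding_not_isReal _ h

variable (W : WeierstrassCurve ℚ) [W.IsElliptic]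

set_option maxHeartbeats 400000 in
/-- ★★ **THE `C₂`-STEP ON `Δ_W < 0`: `μ₂(ℚ(W[2])^{cyc}) = 0 ⟹ μ₂(ℚ(W[2], √−1)^{cyc}) = 0`** (`W/ℚ` elliptic, no rational `2`-torsion abscissa, `Δ_W < 0`,
`−2Δ_W ∉ ℚ²`; `i² = −1`; all cyclotomic `ℤ₂`-extensions, growth form). `ℚ(W[2])` is totally complex and `ℚ(W[2], i) ∩ ℚ_∞ = ℚ` (part AdjoinI), so cell
bsd-2adic's kernel form of Iwasawa's `ℓ = 2` ascent applies to `K = ℚ(W[2])`, `K' = K(i)`; when `i ∈ ℚ(W[2])` the statement is the finite descent along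
`ℚ(W[2]) ⊔ ℚ⟮i⟯ ≤ ℚ(W[2])`. [cite: Iwasawa1973MuInvariants, Thm. 2 and Thm. 3, §4] [cite: Washington1997, §13.1 and §13.3 Prop. 13.23] -/
theorem classicalMuVanishes_sup_adjoin_I_of_divisionField_two_of_Δ_neg (ht : ∀ x : ℚ, ¬ HasRationalTwoTorsionX W x) (hΔ : W.Δ < 0)
    (hm2Δ : ¬ IsSquare (-2 * W.Δ)) {i : AlgebraicClosure ℚ} (hi : i ^ 2 = -1)
    (hT : ∀ κT : ZpExtension (W.divisionField 2) 2, κT.IsCyclotomic → ClassicalMuVanishes κT) :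
    ∀ κL : ZpExtension ↥(W.divisionField 2 ⊔ IntermediateField.adjoin ℚ ({i} : Set (AlgebraicClosure ℚ))) 2,
      κL.IsCyclotomic → ClassicalMuVanishes κL := by
  haveI : Fact (Nat.Prime 2) := ⟨Nat.prime_two⟩
  set Qi : IntermediateField ℚ (AlgebraicClosure ℚ) := IntermediateField.adjoin ℚ ({i} : Set (AlgebraicClosure ℚ)) with hQi
  have hint : IsIntegral ℚ i := by
    refine ⟨X ^ 2 + 1, monic_X_pow_add_C _ two_ne_zero, ?_⟩
    simp [hi]
  haveI : FiniteDimensional ℚ ↥Qi := IntermediateField.adjoin.finiteDimensional hint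
  haveI : NumberField ↥(W.divisionField 2) := NumberField.mk
  haveI : FiniteDimensional ℚ ↥(W.divisionField 2 ⊔ Qi) := IntermediateField.finiteDimensional_sup (W.divisionField 2) Qi
  haveI hNF : NumberField ↥(W.divisionField 2 ⊔ Qi) := NumberField.of_module_finite ℚ _
  by_cases hiT : i ∈ W.divisionField 2
  · -- `ℚ(W[2]) ⊔ ℚ⟮i⟯ ≤ ℚ(W[2])`: finite descent (Iwasawa 1973 §3, no growth theorem)
    have hle : W.divisionField 2 ⊔ Qi ≤ W.divisionField 2 := sup_le le_rfl (adjoin_simple_le_iff.mpr hiT)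
    intro κL hκL
    exact classicalMuVanishes_of_isCyclotomic_of_le_noGrowth hle hT κL hκL
  -- `i ∉ ℚ(W[2])`: the quadratic ascent
  have hsq : ¬ IsSquare W.Δ := fun ⟨r, hr⟩ ↦ by nlinarith [mul_self_nonneg r]
  have h2Δ : ¬ IsSquare (2 * W.Δ) := fun ⟨r, hr⟩ ↦ by nlinarith [mul_self_nonneg r]
  have hiK' : i ∈ W.divisionField 2 ⊔ Qi := (le_sup_right : Qi ≤ W.divisionField 2 ⊔ Qi) (IntermediateField.mem_adjoin_simple_self ℚ i)
  haveI : IsTotallyComplex ↥(W.divisionField 2 ⊔ Qi) := ⟨FineSelmerUpstairs.isComplex_of_mem_sq_eq_neg_one i hi _ hiK'⟩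
  haveI : IsTotallyComplex ↥(W.divisionField 2) := isTotallyComplex_divisionField_two W hΔ
  haveI : Subsingleton (↥(W.divisionField 2) →+* ℝ) := ⟨fun φ _ ↦ (false_of_ringHom_real φ).elim⟩
  have hle : W.divisionField 2 ≤ W.divisionField 2 ⊔ Qi := le_sup_left
  letI : Algebra ↥(W.divisionField 2) ↥(W.divisionField 2 ⊔ Qi) := (IntermediateField.inclusion hle).toRingHom.toAlgebra
  haveI : IsScalarTower ℚ ↥(W.divisionField 2) ↥(W.divisionField 2 ⊔ Qi) := IsScalarTower.of_algebraMap_eq fun _ ↦ rfl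
  -- the generator `x = i ∈ 𝓞`, `x² = −1`
  have hiint : IsIntegral ℤ i := by
    refine ⟨X ^ 2 + 1, monic_X_pow_add_C _ two_ne_zero, ?_⟩
    simp [hi]
  set x : 𝓞 ↥(W.divisionField 2 ⊔ Qi) := ⟨⟨i, hiK'⟩,
    (isIntegral_algHom_iff (IsScalarTower.toAlgHom ℤ ↥(W.divisionField 2 ⊔ Qi) (AlgebraicClosure ℚ)) Subtype.val_injective).mp hiint⟩ with hxdef
  have hm : (-1 : 𝓞 ↥(W.divisionField 2)) ≠ 0 := neg_ne_zero.mpr one_ne_zero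
  have hx : x ^ 2 = algebraMap (𝓞 ↥(W.divisionField 2)) (𝓞 ↥(W.divisionField 2 ⊔ Qi)) (-1) := by
    apply RingOfIntegers.ext
    apply Subtype.ext
    change i ^ 2 = (((algebraMap (𝓞 ↥(W.divisionField 2)) (𝓞 ↥(W.divisionField 2 ⊔ Qi)) (-1) : 𝓞 ↥(W.divisionField 2 ⊔ Qi)) :
      ↥(W.divisionField 2 ⊔ Qi)) : AlgebraicClosure ℚ)
    rw [hi, map_neg, map_one]
    rfl
  -- `K' = K[i]`
  have hgen : Algebra.adjoin ↥(W.divisionField 2) {((x : 𝓞 ↥(W.divisionField 2 ⊔ Qi)) : ↥(W.divisionField 2 ⊔ Qi))} = ⊤ := by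
    set A : Subalgebra ↥(W.divisionField 2) ↥(W.divisionField 2 ⊔ Qi) :=
      Algebra.adjoin ↥(W.divisionField 2) {((x : 𝓞 ↥(W.divisionField 2 ⊔ Qi)) : ↥(W.divisionField 2 ⊔ Qi))} with hA
    let S : Subalgebra ℚ (AlgebraicClosure ℚ) :=
      { carrier := {w | ∃ hw : w ∈ W.divisionField 2 ⊔ Qi, (⟨w, hw⟩ : ↥(W.divisionField 2 ⊔ Qi)) ∈ A}
        mul_mem' := by
          rintro a b ⟨ha, ha'⟩ ⟨hb, hb'⟩
          exact ⟨mul_mem ha hb, by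
            have e : (⟨a * b, mul_mem ha hb⟩ : ↥(W.divisionField 2 ⊔ Qi)) = ⟨a, ha⟩ * ⟨b, hb⟩ := rfl
            rw [e]; exact A.mul_mem ha' hb'⟩
        one_mem' := ⟨one_mem _, by
          have e : (⟨1, one_mem _⟩ : ↥(W.divisionField 2 ⊔ Qi)) = 1 := rfl
          rw [e]; exact A.one_mem⟩
        add_mem' := by
          rintro a b ⟨ha, ha'⟩ ⟨hb, hb'⟩
          exact ⟨add_mem ha hb, by
            have e : (⟨a + b, add_mem ha hb⟩ : ↥(W.divisionField 2 ⊔ Qi)) = ⟨a, ha⟩ + ⟨b, hb⟩ := rfl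
            rw [e]; exact A.add_mem ha' hb'⟩
        zero_mem' := ⟨zero_mem _, by
          have e : (⟨0, zero_mem _⟩ : ↥(W.divisionField 2 ⊔ Qi)) = 0 := rfl
          rw [e]; exact A.zero_mem⟩
        algebraMap_mem' := fun t ↦ ⟨IntermediateField.algebraMap_mem (W.divisionField 2 ⊔ Qi) t, A.algebraMap_mem (algebraMap ℚ ↥(W.divisionField 2) t)⟩ }
    have hKS : ∀ w (hw : w ∈ W.divisionField 2), w ∈ S := fun w hw ↦ ⟨hle hw, by
      have e : (⟨w, hle hw⟩ : ↥(W.divisionField 2 ⊔ Qi)) = algebraMap ↥(W.divisionField 2) ↥(W.divisionField 2 ⊔ Qi) ⟨w, hw⟩ := rfl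
      rw [e]; exact A.algebraMap_mem _⟩
    have hiS : i ∈ S := ⟨hiK', Algebra.subset_adjoin (Set.mem_singleton _)⟩
    have hQiS : Qi.toSubalgebra ≤ S := by
      rw [hQi, IntermediateField.adjoin_simple_toSubalgebra_of_isAlgebraic hint.isAlgebraic]
      exact Algebra.adjoin_le (Set.singleton_subset_iff.mpr hiS)
    have hK'S : (W.divisionField 2 ⊔ Qi).toSubalgebra ≤ S := by
      haveI : Algebra.IsAlgebraic ℚ ↥Qi := Algebra.IsAlgebraic.of_finite ℚ ↥Qi
      rw [IntermediateField.sup_toSubalgebra_of_isAlgebraic_right]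
      exact sup_le (fun w hw ↦ hKS w hw) hQiS
    rw [eq_top_iff]
    rintro ⟨w, hw⟩ -
    obtain ⟨hw', h⟩ := hK'S hw
    exact h
  -- `[K' : K] = 2` (`≤ 2`: minimal polynomial of `i` divides `X² + 1`; `≠ 1`: `i ∉ K`)
  have hdeg : Module.finrank ↥(W.divisionField 2) ↥(W.divisionField 2 ⊔ Qi) = 2 := by
    haveI : FiniteDimensional ↥(W.divisionField 2) ↥(W.divisionField 2 ⊔ Qi) :=
      Module.Finite.of_restrictScalars_finite ℚ ↥(W.divisionField 2) ↥(W.divisionField 2 ⊔ Qi)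
    set y : ↥(W.divisionField 2 ⊔ Qi) := ((x : 𝓞 ↥(W.divisionField 2 ⊔ Qi)) : ↥(W.divisionField 2 ⊔ Qi)) with hy
    have hyint : IsIntegral ↥(W.divisionField 2) y := IsIntegral.of_finite _ y
    have htop : (↥(W.divisionField 2))⟮y⟯ = ⊤ := by
      apply IntermediateField.toSubalgebra_injective
      rw [IntermediateField.adjoin_simple_toSubalgebra_of_isAlgebraic hyint.isAlgebraic, hgen, IntermediateField.top_toSubalgebra]
    have hfin : Module.finrank ↥(W.divisionField 2) ↥(W.divisionField 2 ⊔ Qi) = (minpoly ↥(W.divisionField 2) y).natDegree := by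
      rw [← IntermediateField.adjoin.finrank hyint, htop, IntermediateField.finrank_top']
    have hy2 : y ^ 2 = algebraMap ↥(W.divisionField 2) ↥(W.divisionField 2 ⊔ Qi) (-1) := by
      apply Subtype.ext
      change i ^ 2 = ((algebraMap ↥(W.divisionField 2) ↥(W.divisionField 2 ⊔ Qi) (-1) : ↥(W.divisionField 2 ⊔ Qi)) : AlgebraicClosure ℚ)
      rw [hi, map_neg, map_one]
      rfl
    have hle2 : (minpoly ↥(W.divisionField 2) y).natDegree ≤ 2 := by
      have hp : (X ^ 2 - C (-1 : ↥(W.divisionField 2)) : (↥(W.divisionField 2))[X]) ≠ 0 := X_pow_sub_C_ne_zero two_pos _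
      have hroot : aeval y (X ^ 2 - C (-1 : ↥(W.divisionField 2)) : (↥(W.divisionField 2))[X]) = 0 := by simp [hy2]
      have h := natDegree_le_natDegree (minpoly.degree_le_of_ne_zero ↥(W.divisionField 2) y hp hroot)
      rwa [natDegree_X_pow_sub_C] at h
    have hne : Module.finrank ↥(W.divisionField 2) ↥(W.divisionField 2 ⊔ Qi) ≠ 1 := by
      intro h1
      have hbt : (⊥ : IntermediateField ↥(W.divisionField 2) ↥(W.divisionField 2 ⊔ Qi)) = ⊤ :=
        IntermediateField.bot_eq_top_iff_finrank_eq_one.mpr h1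
      have hyb : y ∈ (⊥ : IntermediateField ↥(W.divisionField 2) ↥(W.divisionField 2 ⊔ Qi)) := by rw [hbt]; trivial
      obtain ⟨t, ht'⟩ := IntermediateField.mem_bot.mp hyb
      apply hiT
      have : (t : AlgebraicClosure ℚ) = i := by
        have h := congrArg (fun z : ↥(W.divisionField 2 ⊔ Qi) ↦ (z : AlgebraicClosure ℚ)) ht'
        exact h
      rw [← this]
      exact t.2
    have hpos : 0 < (minpoly ↥(W.divisionField 2) y).natDegree := minpoly.natDegree_pos hyint
    omega
  -- the cyclotomic tower of `ℚ` restricted to both fields, and the ascent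
  obtain ⟨κ, hκ⟩ := exists_cyclotomicZpExtension_holds ℚ 2
  have hK : Function.Surjective (κ.toContinuousMonoidHom.comp (absGaloisRestrict ℚ ↥(W.divisionField 2))) :=
    surjective_gal_restrict_of_not_isSquare W ht hsq h2Δ κ hκ
  have hK' : Function.Surjective (κ.toContinuousMonoidHom.comp (absGaloisRestrict ℚ ↥(W.divisionField 2 ⊔ Qi))) :=
    @surjective_gal_restrict_sup_adjoin_I W _ ht hsq h2Δ hm2Δ i hi κ hκ hNF
  have h1 : ClassicalMuVanishes (κ.restrict ↥(W.divisionField 2) hK) := hT _ (isCyclotomic_restrict κ hκ _ hK)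
  have h2 : ClassicalMuVanishes (κ.restrict ↥(W.divisionField 2 ⊔ Qi) hK') :=
    classicalMuVanishes_restrict_rat_of_sq_eq κ hκ ↥(W.divisionField 2) ↥(W.divisionField 2 ⊔ Qi) hdeg hm hx hgen hK hK' h1
  intro κL hκL
  exact (classicalMuVanishes_iff_of_isCyclotomic _ _ (isCyclotomic_restrict κ hκ _ hK') hκL).mp h2

/-- ★★★ **PFμ⁺'s CONCLUSION ON `Δ_W < 0` FROM ONE CUBIC TOWER, KERNEL.** `W/ℚ` elliptic, no rational `2`-torsion abscissa, `Δ_W < 0`, `−2Δ_W ∉ ℚ²`;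
`j : Fin 3`, `i² = −1`. If `μ₂ = 0` (growth form) for every cyclotomic `ℤ₂`-extension of the cubic `2`-torsion field `ℚ(β_j)`, then **`μ₂ = 0` for every
cyclotomic `ℤ₂`-extension of `ℚ(W[2], √−1)`** — the three cubic towers from one (part OneRoot), the resolvent `ℚ(√Δ_W)` imaginary quadratic (part Iff,
Kida/Ferrero in the tree), the `S₃` descent to `ℚ(W[2])` (part B), the `C₂`-step above. No Iwasawa 1973 print, no Ferrero–Washington, no narrow data.
[cite: Iwasawa1973MuInvariants, Thm. 2 and Thm. 3] [cite: BiasseEtAl2022, Prop. 3.7] [cite: Ferrero1980AJM, Thm.] [cite: Washington1997, §13.1] -/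
theorem classicalMuVanishes_sup_adjoin_I_of_single_cubic_of_Δ_neg (ht : ∀ x : ℚ, ¬ HasRationalTwoTorsionX W x) (hΔ : W.Δ < 0)
    (hm2Δ : ¬ IsSquare (-2 * W.Δ)) (j : Fin 3)
    (hj : ∀ κj : ZpExtension ↥ℚ⟮xT W two_ne_zero j⟯ 2, κj.IsCyclotomic → ClassicalMuVanishes κj)
    {i : AlgebraicClosure ℚ} (hi : i ^ 2 = -1) :
    ∀ κL : ZpExtension ↥(W.divisionField 2 ⊔ IntermediateField.adjoin ℚ ({i} : Set (AlgebraicClosure ℚ))) 2,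
      κL.IsCyclotomic → ClassicalMuVanishes κL := by
  have hsq : ¬ IsSquare W.Δ := fun ⟨r, hr⟩ ↦ by nlinarith [mul_self_nonneg r]
  have h2Δ : ¬ IsSquare (2 * W.Δ) := fun ⟨r, hr⟩ ↦ by nlinarith [mul_self_nonneg r]
  exact classicalMuVanishes_sup_adjoin_I_of_divisionField_two_of_Δ_neg W ht hΔ hm2Δ hi
    (classicalMuVanishes_divisionField_two_of_single_cubic_of_resolvent W ht hsq h2Δ j hj (classicalMuVanishes_resolvent_of_Δ_neg W hΔ))

/-- **On C2's binders, `Δ_W < 0` half** (`W` globally minimal, good ordinary at `2`, no rational `2`-torsion abscissa, `Δ_W < 0`; `−2Δ_W ∉ ℚ²` is then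
automatic, part AdjoinI §3): `μ₂(ℚ(β_j)^{cyc}) = 0` for one `j` ⟹ `μ₂ = 0` for every cyclotomic `ℤ₂`-extension of `ℚ(W[2], √−1)` and every `i`, `i² = −1` —
the conclusion of `PointFieldMuCycAtTwo` for this `W`. [cite: Iwasawa1973MuInvariants, Thm. 2 and Thm. 3] [cite: SilvermanAEC2009, VII.5 Prop. 5.1(a)] -/
theorem classicalMuVanishes_sup_adjoin_I_of_single_cubic_of_isOrdinaryAt_of_Δ_neg [W.IsGloballyMinimal] (hord : IsOrdinaryAt W 2)
    (ht : ∀ x : ℚ, ¬ HasRationalTwoTorsionX W x) (hΔ : W.Δ < 0) (j : Fin 3)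
    (hj : ∀ κj : ZpExtension ↥ℚ⟮xT W two_ne_zero j⟯ 2, κj.IsCyclotomic → ClassicalMuVanishes κj) :
    ∀ i : AlgebraicClosure ℚ, i ^ 2 = -1 →
      ∀ κL : ZpExtension ↥(W.divisionField 2 ⊔ IntermediateField.adjoin ℚ ({i} : Set (AlgebraicClosure ℚ))) 2,
        κL.IsCyclotomic → ClassicalMuVanishes κL :=
  fun _ hi ↦ classicalMuVanishes_sup_adjoin_I_of_single_cubic_of_Δ_neg W ht hΔ (not_isSquare_neg_two_mul_Δ_of_isOrdinaryAt W hord) j hj hi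

end Summit.BirchSwinnertonDyer.BirchSwinnertonDyer.Theorems.AlignedTransportAtTwoSexticNormRelationDescentAdjoinIAscent

end
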